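import Literature.LinearAlgebra.Matrix.LatimerMacDuffeeOrderStrata
import Literature.LinearAlgebra.Matrix.RankOneMinpoly
import Literature.LinearAlgebra.Matrix.GL2ZTraceZeroNormalForms
import HarnessLib

/-!
# Hertling–Larabi 2026b THEOREM 9.4 and THEOREM 10.3 (d): the `GL₂(ℤ)`-conjugacy classes of SINGULAR integer
# `2 × 2` matrices — unique representatives `(λ μ; 0 0)`, `μ ∈ [0, ½|λ|] ∩ ℤ` (eigenvalues `λ ≠ 0` and `0`), and
# `(0 m; 0 0)`, `m ∈ ℕ` (nilpotent); `⌊|λ|/2⌋ + 1` classes; the order `ℤ·1 + ℤ·t̄/gcd(λ, μ)` of the class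

[topic LinearAlgebra/Matrix] Sequel to `LatimerMacDuffeeOrderStrata` (HL26b Rem. 6.3 (v): the order of a `GLₙ(ℤ)`-class)
and `IntegerMatrixBinaryQuadraticForms` (HL26b Lemma 7.2 (b), the `2 × 2` dictionary with binary quadratic forms):
the two families of SINGULAR `2 × 2` classes that Hertling–Larabi work out completely in their §9.2 (the split
algebra `A = ℚe₁ ⊕ ℚe₂`, matrices with eigenvalues `λ` and `0`) and §10.2 (`A = ℚ[a]/(a²)`, nilpotent matrices).
Lane `lit-hodgefound` (Track 2 foundations library), seat p19 generation 38, row g38-#6.  THEOREMS ONLY: no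
definition, no instance, no notation, no named fact (D-0026, net Literature debt `0`), no `sorry`.

## Source, VERBATIM

C. Hertling, K. Larabi, *Conjugacy classes of regular integer matrices*, arXiv:2602.15748 (2026)
[HertlingLarabi2026b], held `paper:arxiv-2602.15748`.
* §9.2, chunk p0029, **Theorem 9.4.** «Each conjugacy class of `2×2` matrices with eigenvalues `λ ∈ ℕ` and `0`
  has a unique representative `(λ μ; 0 0)` with `μ ∈ [0, ½λ] ∩ ℤ`.  This matrix comes from an `ε`-class of full
  lattices with order with `ℤ`-basis `e(α 1; 0 1)` where `α = λ/(λ,μ)`.»  It is obtained (chunk p0028, Example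
  9.3) from Theorem 6.3 and Theorem 9.1 (d): «the conjugacy classes of integer `2×2` matrices with eigenvalues `λ`
  and `0` correspond to the `ε`-classes of full lattices `L` with `𝒪(L) ⊃ Λ` where `Λ` is the order `Λ = ℤ[λe₁]`
  […] `{[L]_ε | 𝒪(L) ⊃ Λ} = ⋃_{α ∈ ℕ: α|λ} {[L_δ]_ε | δ = β/α with β ∈ [0, ½α] ∩ ℤ_α^{unit}}`.  The `ℤ`-basis
  `e(1 δ; 0 1)` of a full lattice `L_δ` […] gives rise to the matrix `M_δ` with `λe₁·e(1 δ; 0 1) = e(1 δ; 0 1)·M_δ`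
  so `M_δ = (λ λδ; 0 0) = (λ λβ/α; 0 0)`.»
* §10.2, chunk p0034, **Theorem 10.3.** «Let `A = ℚ·1_A + ℚ·a` with `a² = 0`. […] (d) Each conjugacy class of
  nilpotent `2×2` matrices `≠ 0` has a unique representative `(0 m; 0 0)` with `m ∈ ℕ`.  It comes from the
  `ε`-class of full lattices which contains the order `ℤ·1_A + ℤ·(1/m)a`.»  Proof of (d): «By Theorem 6.3 there is
  a 1:1 correspondence between the set of conjugacy classes of nilpotent `2×2` matrices `≠ 0` and the set of
  `ε`-classes `[L]_ε` of full lattices with `𝒪(L) ⊃ L_{st}`. Choose in such an `ε`-class the order. It is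
  `ℤ·1_A + ℤ·(1/m)a` for some `m ∈ ℕ`. With respect to the `ℚ`-basis `((1/m)a, 1_A)` we obtain the nilpotent
  `2×2` matrix `M` with `a·((1/m)a, 1_A) = (0, a) = ((1/m)a, 1_A)·M`, so `M = (0 m; 0 0)`.»
* §6 Def./Lemma 6.1 (e), chunk p0012: «`[B]_ℤ := {C⁻¹BC | C ∈ GL_n(ℤ)}` the `GL_n(ℤ)`-conjugacy class of `B`»;
  here, as in the tree's Latimer–MacDuffee files, `B ∼ B' :⟺ ∃ P ∈ M_{2×2}(ℤ), det P = ±1, PB = B'P`.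

## The route (elementary; HL's lattice route is recovered in §5)

HL deduce both theorems from their classification of full lattices (Thm. 9.1 (b)/(d), Thm. 10.3 (b)) through
Theorem 6.3 (`GLₙ(ℤ)`-classes ↔ `ε`-classes).  At the level of matrices the statements have a direct proof,
which is what §§1–4 formalize (same representatives, same count), and §5 then identifies the ORDER of the class —
the datum HL attach to the representative — in the tree's Latimer–MacDuffee vocabulary:
* §1 `exists_det_eq_one_mul_eq`: `det B = 0` gives a primitive row `w` with `wB = 0`; completing it to
  `P ∈ SL₂(ℤ)` (Bezout, tree `GL2ZNormalForm.exists_primitive`) yields `PBP⁻¹ = (tr B, μ; 0, 0)`.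
* §2 the moves `(1 k; 0 1)`: `μ ↦ μ − k·tr B` (`shear_conj`) and `diag(1, −1)`: `μ ↦ −μ` (`sign_conj`), and the
  converse computation `exists_eq_mul_add_or_sub_of_conj`: a conjugation `P` between `(t μ; 0 0)` and
  `(t μ'; 0 0)`, `t ≠ 0`, is upper triangular with diagonal `±1`, so `μ ≡ ±μ' (mod t)`.
* §3 **THEOREM 9.4**: `exists_conj_normalForm`, `normalForm_unique`, `existsUnique_conj_normalForm` (for `tr B = λ ≠ 0`
  of either sign, `μ ∈ [0, ½|λ|]`; HL state `λ ∈ ℕ`), and the count **`natCard_quot_conj_eq`: the classes with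
  `tr = λ`, `det = 0` number `⌊|λ|/2⌋ + 1`**.
* §4 **THEOREM 10.3 (d)**: `isNilpotent_iff_trace_eq_zero_and_det_eq_zero`, `exists_conj_nilpotent_normalForm`,
  `nilpotent_normalForm_unique`, `existsUnique_conj_nilpotent_normalForm`, `conj_nilpotent_normalForm_ne_zero_iff`
  (`m ≠ 0 ⟺ N ≠ 0`), `exists_bijective_quot_conj_nilpotent` (classes of nilpotent matrices `↔ ℕ₀`).
* §5 the order: `exists_int_eq_smul_one_add_smul_iff` (`x·1 + y·(λ μ; 0 0) ∈ M_{2×2}(ℤ) ⟺ x ∈ ℤ ∧ y·gcd(λ,μ) ∈ ℤ`,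
  i.e. `ℚ[B] ∩ M_{2×2}(ℤ) = ℤ·1 ⊕ ℤ·B/gcd(λ, μ)`), `minpoly_map_normalForm` (`p_B = t(t − λ)`, via the tree's
  `RankOneMinpoly`), **`mk_mem_span_iff` / `order_eq_span_of_normalForm`: the order of `[(λ μ; 0 0)]_ℤ` is
  `ℤ·1 + ℤ·t̄/gcd(λ, μ) ⊂ A_f`**, `f = t(t − λ)` — for `λ ≠ 0` this is `ℤ[t]/(t(t − α)) = Λ_α`, `α = λ/gcd(λ, μ)`
  (under `A_f ≅ ℚe₁ ⊕ ℚe₂`, `t̄ ↦ λe₁`: the lattice `ℤ·αe₁ + ℤ·1_A = e(α 1; 0 1)·ℤ²` of Thm. 9.4), for `λ = 0` it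
  is `ℤ·1_A + ℤ·(1/m)a` of Thm. 10.3 (d) — and `exists_lattice_of_normalForm` (with the tree's Thm. 6.2,
  `LatimerMacDuffeeOrderStrata.exists_order_of_minpoly_eq`: the representative comes from a full `t̄`-stable
  lattice `L` with `𝒪(L)` equal to that order).
NOT here: Thm. 9.1 itself (the classification of all full lattices of `ℚe₁ ⊕ ℚe₂` and `|G([Λ_α]_ε)| = φ(α)/2`),
Thm. 10.3 (a)–(c), the rank-3 cases §9.3/§10.3.

## References

* [HertlingLarabi2026b] C. Hertling, K. Larabi, *Conjugacy classes of regular integer matrices*, arXiv:2602.15748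
  (2026), §9.2 Example 9.3, Theorem 9.4 (chunks p0028–p0029); §10.2 Theorem 10.3 (d) and proof (chunk p0034);
  §6 Def./Lemma 6.1 (e), Theorem 6.2 (chunk p0012), Rem. 6.3 (v) (chunk p0013).
  [cite: HertlingLarabi2026b, §9.2 Thm. 9.4; §10.2 Thm. 10.3 (d)]
* [HertlingLarabi2026] C. Hertling, K. Larabi, *Semigroups from full lattices in commutative ℚ-algebras*,
  arXiv:2602.14973 (2026) (the `ε`-classes / orders language of §5).
-/

open Polynomial Matrix

namespace Literature.LinearAlgebra.Matrix.GL2ZSingularNormalForm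

open Literature.LinearAlgebra.Matrix.GL2ZNormalForm (exists_primitive)
open Literature.LinearAlgebra.Matrix.LatimerMacDuffeeOrderStrata (equivalence_conj exists_order_of_minpoly_eq
  order_unique)
open Literature.NumberTheory.Automorphic (IsFullLattice)

/-! ## §1 Reduction: a singular matrix is `SL₂(ℤ)`-conjugate to `(tr B, μ; 0, 0)` -/

/-- **Reduction step** (the elementary core of HL26b Thm. 9.4 / Thm. 10.3 (d), cf. Example 9.3): if `det B = 0`
then a primitive row vector `w` with `wB = 0` exists; completing it to `P = (v; w) ∈ SL₂(ℤ)` (Bezout) gives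
`PBP⁻¹ = (tr B, μ; 0, 0)`, i.e. `P·B = (tr B, μ; 0, 0)·P` for some `μ ∈ ℤ`.
[cite: HertlingLarabi2026b, §9.2 Example 9.3 and Theorem 9.4, chunks p0028–p0029] -/
theorem exists_det_eq_one_mul_eq (B : Matrix (Fin 2) (Fin 2) ℤ) (hB : B.det = 0) :
    ∃ P : Matrix (Fin 2) (Fin 2) ℤ, P.det = 1 ∧ ∃ μ : ℤ, P * B = !![B.trace, μ; 0, 0] * P := by
  -- a nonzero row vector `u` with `u B = 0`
  obtain ⟨u₁, u₂, hu, hk₁, hk₂⟩ : ∃ u₁ u₂ : ℤ, (u₁ ≠ 0 ∨ u₂ ≠ 0) ∧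
      u₁ * B 0 0 + u₂ * B 1 0 = 0 ∧ u₁ * B 0 1 + u₂ * B 1 1 = 0 := by
    have hdet : B 0 0 * B 1 1 - B 0 1 * B 1 0 = 0 := by rw [← Matrix.det_fin_two]; exact hB
    by_cases hc : B 0 0 = 0 ∧ B 1 0 = 0
    · by_cases hc' : B 0 1 = 0 ∧ B 1 1 = 0
      · exact ⟨1, 0, Or.inl one_ne_zero, by rw [hc.1, hc.2]; ring, by rw [hc'.1, hc'.2]; ring⟩
      · refine ⟨B 1 1, -B 0 1, ?_, by rw [hc.1, hc.2]; ring, by ring⟩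
        rw [not_and_or] at hc'
        rcases hc' with h | h
        · exact Or.inr (neg_ne_zero.2 h)
        · exact Or.inl h
    · refine ⟨B 1 0, -B 0 0, ?_, by ring, by linear_combination -hdet⟩
      rw [not_and_or] at hc
      rcases hc with h | h
      · exact Or.inr (neg_ne_zero.2 h)
      · exact Or.inl h
  -- make it primitive and complete it to `P ∈ SL₂(ℤ)` with second row `w`
  obtain ⟨g, w₁, w₂, hg, rfl, rfl, hw⟩ := exists_primitive u₁ u₂ hu
  have hw₁ : w₁ * B 0 0 + w₂ * B 1 0 = 0 := by
    have h : g * (w₁ * B 0 0 + w₂ * B 1 0) = 0 := by rw [← hk₁]; ring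
    exact (mul_eq_zero.1 h).resolve_left hg.ne'
  have hw₂ : w₁ * B 0 1 + w₂ * B 1 1 = 0 := by
    have h : g * (w₁ * B 0 1 + w₂ * B 1 1) = 0 := by rw [← hk₂]; ring
    exact (mul_eq_zero.1 h).resolve_left hg.ne'
  obtain ⟨a, b, hab⟩ := hw
  set P : Matrix (Fin 2) (Fin 2) ℤ := !![b, -a; w₁, w₂] with hPdef
  have hP : P.det = 1 := by rw [hPdef, Matrix.det_fin_two_of]; linear_combination hab
  have hr0 : (P * B) 1 0 = 0 := by
    rw [Matrix.mul_apply, Fin.sum_univ_two]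
    simpa [hPdef] using hw₁
  have hr1 : (P * B) 1 1 = 0 := by
    rw [Matrix.mul_apply, Fin.sum_univ_two]
    simpa [hPdef] using hw₂
  -- `C := P B adj(P)` is an integer matrix with `C P = P B`, zero second row and trace `tr B`
  set C : Matrix (Fin 2) (Fin 2) ℤ := P * B * P.adjugate with hCdef
  have hCP : C * P = P * B := by
    rw [hCdef, Matrix.mul_assoc (P * B), Matrix.adjugate_mul, hP, one_smul, Matrix.mul_one]
  have hC10 : C 1 0 = 0 := by
    rw [hCdef, Matrix.mul_apply, Fin.sum_univ_two, hr0, hr1, zero_mul, zero_mul, add_zero]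
  have hC11 : C 1 1 = 0 := by
    rw [hCdef, Matrix.mul_apply, Fin.sum_univ_two, hr0, hr1, zero_mul, zero_mul, add_zero]
  have hC00 : C 0 0 = B.trace := by
    have h : C.trace = B.trace := by
      rw [hCdef, Matrix.trace_mul_cycle, Matrix.adjugate_mul, hP, one_smul, Matrix.one_mul]
    rwa [Matrix.trace_fin_two, hC11, add_zero] at h
  refine ⟨P, hP, C 0 1, ?_⟩
  rw [← hCP]
  congr 1
  ext i j
  fin_cases i <;> fin_cases j <;> simp [hC00, hC10, hC11]

/-! ## §2 The conjugacy relation and the two elementary moves (shear, sign) -/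

/-- Transitivity of `GL₂(ℤ)`-conjugacy `B ∼ B' :⟺ ∃ P unimodular, PB = B'P` (HL26b Def./Lemma 6.1 (e)). [folklore] -/
private theorem conj_trans {B B' B'' : Matrix (Fin 2) (Fin 2) ℤ}
    (h : ∃ P : Matrix (Fin 2) (Fin 2) ℤ, IsUnit P.det ∧ P * B = B' * P)
    (h' : ∃ P : Matrix (Fin 2) (Fin 2) ℤ, IsUnit P.det ∧ P * B' = B'' * P) :
    ∃ P : Matrix (Fin 2) (Fin 2) ℤ, IsUnit P.det ∧ P * B = B'' * P := by
  obtain ⟨P, hP, h⟩ := h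
  obtain ⟨Q, hQ, h'⟩ := h'
  refine ⟨Q * P, by rw [Matrix.det_mul]; exact hQ.mul hP, ?_⟩
  rw [Matrix.mul_assoc, h, ← Matrix.mul_assoc, h', Matrix.mul_assoc]

/-- Symmetry of `GL₂(ℤ)`-conjugacy. [folklore] -/
private theorem conj_symm {B B' : Matrix (Fin 2) (Fin 2) ℤ}
    (h : ∃ P : Matrix (Fin 2) (Fin 2) ℤ, IsUnit P.det ∧ P * B = B' * P) :
    ∃ P : Matrix (Fin 2) (Fin 2) ℤ, IsUnit P.det ∧ P * B' = B * P := by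
  obtain ⟨P, hP, hPB⟩ := h
  refine ⟨P⁻¹, Matrix.isUnit_nonsing_inv_det P hP, ?_⟩
  calc P⁻¹ * B' = P⁻¹ * B' * (P * P⁻¹) := by rw [Matrix.mul_nonsing_inv P hP, Matrix.mul_one]
    _ = P⁻¹ * (B' * P) * P⁻¹ := by simp only [Matrix.mul_assoc]
    _ = P⁻¹ * (P * B) * P⁻¹ := by rw [hPB]
    _ = B * P⁻¹ := by rw [← Matrix.mul_assoc, Matrix.nonsing_inv_mul P hP, Matrix.one_mul]

/-- **Shear move**: conjugating by `(1 k; 0 1)` replaces `μ` by `μ − tk` in `(t μ; 0 0)`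
(HL26b Ex. 9.3: the basis change `e(1 δ; 0 1)`). [cite: HertlingLarabi2026b, §9.2 Example 9.3, chunk p0028] -/
theorem shear_conj (t μ k : ℤ) :
    ∃ P : Matrix (Fin 2) (Fin 2) ℤ, IsUnit P.det ∧ P * !![t, μ; 0, 0] = !![t, μ - t * k; 0, 0] * P := by
  refine ⟨!![1, k; 0, 1], by rw [Matrix.det_fin_two_of]; simp, ?_⟩
  ext i j
  fin_cases i <;> fin_cases j <;> simp [Matrix.mul_apply, Fin.sum_univ_two]

/-- **Sign move**: conjugating by `diag(1, −1) ∈ GL₂(ℤ) ∖ SL₂(ℤ)` replaces `μ` by `−μ` in `(t μ; 0 0)`.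
[cite: HertlingLarabi2026b, §9.2 Theorem 9.4, chunk p0029] -/
theorem sign_conj (t μ : ℤ) :
    ∃ P : Matrix (Fin 2) (Fin 2) ℤ, IsUnit P.det ∧ P * !![t, μ; 0, 0] = !![t, -μ; 0, 0] * P := by
  refine ⟨!![1, 0; 0, -1], by rw [Matrix.det_fin_two_of]; simp, ?_⟩
  ext i j
  fin_cases i <;> fin_cases j <;> simp [Matrix.mul_apply, Fin.sum_univ_two]

/-- What a conjugation between two upper normal forms `(t μ; 0 0)`, `(t μ'; 0 0)` with `t ≠ 0` looks like:
`P = (p q; 0 s)` is triangular with `p, s = ±1`, whence **`μ ≡ ±μ' (mod t)`**.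
[cite: HertlingLarabi2026b, §9.2 Theorem 9.4 (uniqueness of the representative), chunk p0029] -/
theorem exists_eq_mul_add_or_sub_of_conj {t μ μ' : ℤ} (ht : t ≠ 0) {P : Matrix (Fin 2) (Fin 2) ℤ}
    (hP : IsUnit P.det) (h : P * !![t, μ; 0, 0] = !![t, μ'; 0, 0] * P) :
    ∃ k : ℤ, μ = t * k + μ' ∨ μ = t * k - μ' := by
  have e10 := congr_fun (congr_fun h 1) 0
  have e01 := congr_fun (congr_fun h 0) 1
  simp [Matrix.mul_apply, Fin.sum_univ_two] at e10 e01
  -- `e10 : P 1 0 * t = 0`, `e01 : P 0 0 * μ = t * P 0 1 + μ' * P 1 1`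
  have hr : P 1 0 = 0 := by
    rcases e10 with h0 | h0
    · exact h0
    · exact absurd h0 ht
  have hdet : P 0 0 * P 1 1 = 1 ∨ P 0 0 * P 1 1 = -1 := by
    have hd := Int.isUnit_iff.1 hP
    rwa [Matrix.det_fin_two, hr, mul_zero, sub_zero] at hd
  rcases hdet with hd | hd
  · rcases Int.eq_one_or_neg_one_of_mul_eq_one' hd with ⟨hp, hs⟩ | ⟨hp, hs⟩
    · exact ⟨P 0 1, Or.inl (by rw [hp, hs] at e01; linear_combination e01)⟩
    · exact ⟨-P 0 1, Or.inl (by rw [hp, hs] at e01; linear_combination -e01)⟩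
  · rcases Int.eq_one_or_neg_one_of_mul_eq_neg_one' hd with ⟨hp, hs⟩ | ⟨hp, hs⟩
    · exact ⟨P 0 1, Or.inr (by rw [hp, hs] at e01; linear_combination e01)⟩
    · exact ⟨-P 0 1, Or.inr (by rw [hp, hs] at e01; linear_combination -e01)⟩

/-- For `t ≠ 0`: `tk` is `0` or at least `|t|` in absolute value. [folklore] -/
private theorem mul_eq_zero_or_abs_le (t k : ℤ) : t * k = 0 ∨ |t| ≤ t * k ∨ t * k ≤ -|t| := by
  by_cases hk : k = 0
  · exact Or.inl (by rw [hk, mul_zero])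
  · have h : |t| ≤ |t * k| := by
      rw [abs_mul]
      exact le_mul_of_one_le_right (abs_nonneg t) (Int.one_le_abs hk)
    rcases le_abs'.1 h with h | h
    · exact Or.inr (Or.inr h)
    · exact Or.inr (Or.inl h)

/-! ## §3 THEOREM 9.4: eigenvalues `λ ≠ 0` and `0` — the unique representative `(λ μ; 0 0)`, `0 ≤ μ ≤ ½|λ|` -/

/-- **THEOREM 9.4 (existence)**: an integer `2 × 2` matrix with eigenvalues `λ = tr B ≠ 0` and `0` (`det B = 0`)
is `GL₂(ℤ)`-conjugate to `(λ m; 0 0)` for some integer `m` with `0 ≤ m ≤ ½|λ|`.  (HL: `λ ∈ ℕ`; for `λ < 0` apply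
the statement to `−B`, which is what `|λ|` records.) [cite: HertlingLarabi2026b, §9.2 Theorem 9.4, chunk p0029] -/
theorem exists_conj_normalForm {B : Matrix (Fin 2) (Fin 2) ℤ} (hB : B.det = 0) (ht : B.trace ≠ 0) :
    ∃ m : ℕ, 2 * m ≤ B.trace.natAbs ∧
      ∃ P : Matrix (Fin 2) (Fin 2) ℤ, IsUnit P.det ∧ P * B = !![B.trace, (m : ℤ); 0, 0] * P := by
  obtain ⟨P, hP, μ, hPB⟩ := exists_det_eq_one_mul_eq B hB
  set t := B.trace with ht_def
  -- shear to the remainder `r = μ mod t ∈ [0, |t|)`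
  have h1 : ∃ Q : Matrix (Fin 2) (Fin 2) ℤ, IsUnit Q.det ∧ Q * B = !![t, μ % t; 0, 0] * Q := by
    have h := conj_trans ⟨P, by rw [hP]; exact isUnit_one, hPB⟩ (shear_conj t μ (μ / t))
    rwa [← Int.emod_def] at h
  have hr0 : 0 ≤ μ % t := Int.emod_nonneg μ ht
  have hr1 : μ % t < (t.natAbs : ℤ) := Int.emod_lt μ ht
  by_cases hle : 2 * (μ % t) ≤ (t.natAbs : ℤ)
  · refine ⟨(μ % t).toNat, by omega, ?_⟩
    rwa [Int.toNat_of_nonneg hr0]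
  · -- otherwise flip the sign and shear once more: `|t| − r ∈ (0, ½|t|)`
    have h2 := conj_trans h1 (sign_conj t (μ % t))
    have h3 : ∃ Q : Matrix (Fin 2) (Fin 2) ℤ, IsUnit Q.det ∧ Q * B = !![t, (t.natAbs : ℤ) - μ % t; 0, 0] * Q := by
      rcases Int.natAbs_eq t with hs | hs
      · have h := conj_trans h2 (shear_conj t (-(μ % t)) (-1))
        have e : -(μ % t) - t * -1 = (t.natAbs : ℤ) - μ % t := by omega
        rwa [e] at h
      · have h := conj_trans h2 (shear_conj t (-(μ % t)) 1)
        have e : -(μ % t) - t * 1 = (t.natAbs : ℤ) - μ % t := by omega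
        rwa [e] at h
    refine ⟨((t.natAbs : ℤ) - μ % t).toNat, by omega, ?_⟩
    rwa [Int.toNat_of_nonneg (by omega)]

/-- **THEOREM 9.4 (uniqueness)**: if `(t m; 0 0)` and `(t m'; 0 0)` with `t ≠ 0`, `0 ≤ m, m' ≤ ½|t|` are
`GL₂(ℤ)`-conjugate then `m = m'`. [cite: HertlingLarabi2026b, §9.2 Theorem 9.4, chunk p0029] -/
theorem normalForm_unique {t : ℤ} (ht : t ≠ 0) {m m' : ℕ} (hm : 2 * m ≤ t.natAbs) (hm' : 2 * m' ≤ t.natAbs)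
    {P : Matrix (Fin 2) (Fin 2) ℤ} (hP : IsUnit P.det)
    (h : P * !![t, (m : ℤ); 0, 0] = !![t, (m' : ℤ); 0, 0] * P) : m = m' := by
  obtain ⟨k, hk⟩ := exists_eq_mul_add_or_sub_of_conj ht hP h
  have htri := mul_eq_zero_or_abs_le t k
  rw [Int.abs_eq_natAbs] at htri
  have hpos : 0 < (t.natAbs : ℤ) := by
    have := Int.natAbs_pos.2 ht
    exact_mod_cast this
  have hmz : 2 * (m : ℤ) ≤ (t.natAbs : ℤ) := by exact_mod_cast hm
  have hmz' : 2 * (m' : ℤ) ≤ (t.natAbs : ℤ) := by exact_mod_cast hm'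
  rcases hk with hk | hk <;> omega

/-- **THEOREM 9.4** «Each conjugacy class of `2×2` matrices with eigenvalues `λ ∈ ℕ` and `0` has a unique
representative `(λ μ; 0 0)` with `μ ∈ [0, ½λ] ∩ ℤ`» — for every `B ∈ M_{2×2}(ℤ)` with `det B = 0`, `λ = tr B ≠ 0`
there is exactly one `m ∈ ℕ`, `2m ≤ |λ|`, with `B ∼ (λ m; 0 0)`. [cite: HertlingLarabi2026b, §9.2 Theorem 9.4, chunk
p0029] -/
theorem existsUnique_conj_normalForm {B : Matrix (Fin 2) (Fin 2) ℤ} (hB : B.det = 0) (ht : B.trace ≠ 0) :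
    ∃! m : ℕ, 2 * m ≤ B.trace.natAbs ∧
      ∃ P : Matrix (Fin 2) (Fin 2) ℤ, IsUnit P.det ∧ P * B = !![B.trace, (m : ℤ); 0, 0] * P := by
  obtain ⟨m, hm, hconj⟩ := exists_conj_normalForm hB ht
  refine ⟨m, ⟨hm, hconj⟩, fun m' ⟨hm', hconj'⟩ => ?_⟩
  obtain ⟨P, hP, h⟩ := conj_trans (conj_symm hconj') hconj
  exact normalForm_unique ht hm' hm hP h

/-- **THEOREM 9.4, counted**: for `λ ≠ 0` the `GL₂(ℤ)`-conjugacy classes of integer `2 × 2` matrices with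
eigenvalues `λ` and `0` (`tr B = λ`, `det B = 0`) are in bijection with `{m ∈ ℕ | 2m ≤ |λ|}`; there are exactly
`⌊|λ|/2⌋ + 1` of them (HL26b Ex. 9.3: one class `[L_δ]_ε`, `δ = β/α ∈ [0, ½]`, `α | λ`, per representative).
[cite: HertlingLarabi2026b, §9.2 Example 9.3 and Theorem 9.4, chunks p0028–p0029] -/
theorem natCard_quot_conj_eq {t : ℤ} (ht : t ≠ 0) :
    Nat.card (Quot fun B B' : {B : Matrix (Fin 2) (Fin 2) ℤ // B.trace = t ∧ B.det = 0} =>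
      ∃ P : Matrix (Fin 2) (Fin 2) ℤ, IsUnit P.det ∧ P * B.1 = B'.1 * P) = t.natAbs / 2 + 1 := by
  set S := {B : Matrix (Fin 2) (Fin 2) ℤ // B.trace = t ∧ B.det = 0}
  set r : S → S → Prop := fun B B' => ∃ P : Matrix (Fin 2) (Fin 2) ℤ, IsUnit P.det ∧ P * B.1 = B'.1 * P
    with hr_def
  have hr : Equivalence r := equivalence_conj _
  -- the normal forms as elements of `S`
  have hN : ∀ m : ℕ, (!![t, (m : ℤ); 0, 0] : Matrix (Fin 2) (Fin 2) ℤ).trace = t ∧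
      (!![t, (m : ℤ); 0, 0] : Matrix (Fin 2) (Fin 2) ℤ).det = 0 := fun m => by
    rw [Matrix.trace_fin_two_of, Matrix.det_fin_two_of]; constructor <;> ring
  set N : {m : ℕ // 2 * m ≤ t.natAbs} → S := fun m => ⟨!![t, (m.1 : ℤ); 0, 0], hN m.1⟩ with hN_def
  -- the invariant `m(B)`
  have hex : ∀ B : S, ∃ m : {m : ℕ // 2 * m ≤ t.natAbs}, r B (N m) := fun B => by
    have ht' : B.1.trace ≠ 0 := by rw [B.2.1]; exact ht
    obtain ⟨m, hm, hconj⟩ := exists_conj_normalForm B.2.2 ht'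
    rw [B.2.1] at hm hconj
    exact ⟨⟨m, hm⟩, hconj⟩
  choose f hf using hex
  have hU : ∀ m m' : {m : ℕ // 2 * m ≤ t.natAbs}, r (N m) (N m') → m = m' := by
    rintro ⟨m, hm⟩ ⟨m', hm'⟩ ⟨P, hP, h⟩
    exact Subtype.ext (normalForm_unique ht hm hm' hP h)
  have hwd : ∀ B B' : S, r B B' → f B = f B' := fun B B' h =>
    hU _ _ (hr.trans (hr.trans (hr.symm (hf B)) h) (hf B'))
  have hbij : Function.Bijective (Quot.lift f hwd) := by
    constructor
    · rintro ⟨B⟩ ⟨B'⟩ h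
      change f B = f B' at h
      exact Quot.sound (hr.trans (hf B) (h ▸ hr.symm (hf B')))
    · intro m
      exact ⟨Quot.mk r (N m), hU _ _ (hr.trans (hr.symm (hf (N m))) (hr.refl _))⟩
  rw [Nat.card_eq_of_bijective _ hbij]
  have e : {m : ℕ // 2 * m ≤ t.natAbs} ≃ Fin (t.natAbs / 2 + 1) :=
    { toFun := fun m => ⟨m.1, by have := m.2; omega⟩
      invFun := fun i => ⟨i.1, by have := i.2; omega⟩
      left_inv := fun m => Subtype.ext rfl
      right_inv := fun i => Fin.ext rfl }
  rw [Nat.card_congr e, Nat.card_eq_fintype_card, Fintype.card_fin]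

/-! ## §4 THEOREM 10.3 (d): nilpotent matrices — the unique representative `(0 m; 0 0)`, `m ∈ ℕ` -/

/-- A `2 × 2` integer matrix is nilpotent iff its trace and determinant vanish (then `N² = 0`, Cayley–Hamilton).
[folklore] (used by HL26b §10.2 for `A = ℚ[a]/(a²)`, chunk p0034) [cite: HertlingLarabi2026b, §10.2 Theorem 10.3,
chunk p0034] -/
theorem isNilpotent_iff_trace_eq_zero_and_det_eq_zero (N : Matrix (Fin 2) (Fin 2) ℤ) :
    IsNilpotent N ↔ N.trace = 0 ∧ N.det = 0 := by
  constructor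
  · intro hN
    refine ⟨(Matrix.isNilpotent_trace_of_isNilpotent hN).eq_zero, ?_⟩
    obtain ⟨k, hk⟩ := hN
    have h : IsNilpotent N.det := ⟨k, by rw [← Matrix.det_pow, hk, Matrix.det_zero]⟩
    exact h.eq_zero
  · rintro ⟨htr, hdet⟩
    have htr' : N 0 0 + N 1 1 = 0 := by rw [← Matrix.trace_fin_two]; exact htr
    have hdet' : N 0 0 * N 1 1 - N 0 1 * N 1 0 = 0 := by rw [← Matrix.det_fin_two]; exact hdet
    refine ⟨2, ?_⟩
    rw [pow_two]
    ext i j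
    rw [Matrix.mul_apply, Fin.sum_univ_two, Matrix.zero_apply]
    fin_cases i <;> fin_cases j
    · change N 0 0 * N 0 0 + N 0 1 * N 1 0 = 0
      linear_combination (N 0 0) * htr' - hdet'
    · change N 0 0 * N 0 1 + N 0 1 * N 1 1 = 0
      linear_combination (N 0 1) * htr'
    · change N 1 0 * N 0 0 + N 1 1 * N 1 0 = 0
      linear_combination (N 1 0) * htr'
    · change N 1 0 * N 0 1 + N 1 1 * N 1 1 = 0
      linear_combination (N 1 1) * htr' - hdet'

/-- **THEOREM 10.3 (d) (existence)**: a nilpotent integer `2 × 2` matrix is `GL₂(ℤ)`-conjugate to `(0 m; 0 0)` for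
some `m ∈ ℕ₀` (`m = 0` iff `N = 0`). [cite: HertlingLarabi2026b, §10.2 Theorem 10.3 (d), chunk p0034] -/
theorem exists_conj_nilpotent_normalForm {N : Matrix (Fin 2) (Fin 2) ℤ} (hN : IsNilpotent N) :
    ∃ m : ℕ, ∃ P : Matrix (Fin 2) (Fin 2) ℤ, IsUnit P.det ∧ P * N = !![0, (m : ℤ); 0, 0] * P := by
  obtain ⟨htr, hdet⟩ := (isNilpotent_iff_trace_eq_zero_and_det_eq_zero N).1 hN
  obtain ⟨P, hP, μ, hPB⟩ := exists_det_eq_one_mul_eq N hdet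
  rw [htr] at hPB
  rcases le_or_gt 0 μ with hμ | hμ
  · exact ⟨μ.toNat, P, by rw [hP]; exact isUnit_one, by rwa [Int.toNat_of_nonneg hμ]⟩
  · refine ⟨(-μ).toNat, ?_⟩
    rw [Int.toNat_of_nonneg (by omega)]
    exact conj_trans ⟨P, by rw [hP]; exact isUnit_one, hPB⟩ (sign_conj 0 μ)

/-- **THEOREM 10.3 (d) (uniqueness)**: `(0 m; 0 0) ∼ (0 m'; 0 0)` under `GL₂(ℤ)` with `m, m' ∈ ℕ₀` forces
`m = m'` (`m` is the content of the matrix). [cite: HertlingLarabi2026b, §10.2 Theorem 10.3 (d), chunk p0034] -/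
theorem nilpotent_normalForm_unique {m m' : ℕ} {P : Matrix (Fin 2) (Fin 2) ℤ} (hP : IsUnit P.det)
    (h : P * !![0, (m : ℤ); 0, 0] = !![0, (m' : ℤ); 0, 0] * P) : m = m' := by
  have e00 := congr_fun (congr_fun h 0) 0
  have e01 := congr_fun (congr_fun h 0) 1
  have e11 := congr_fun (congr_fun h 1) 1
  simp [Matrix.mul_apply, Fin.sum_univ_two] at e00 e01 e11
  -- `e00 : m' = 0 ∨ P 1 0 = 0`, `e01 : P 0 0 * m = m' * P 1 1`, `e11 : P 1 0 = 0 ∨ m = 0`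
  have hd := Int.isUnit_iff.1 hP
  rw [Matrix.det_fin_two] at hd
  by_cases hr : P 1 0 = 0
  · rw [hr, mul_zero, sub_zero] at hd
    have hps : (P 0 0 = 1 ∨ P 0 0 = -1) ∧ (P 1 1 = 1 ∨ P 1 1 = -1) := by
      rcases hd with hd | hd
      · rcases Int.eq_one_or_neg_one_of_mul_eq_one' hd with ⟨hp, hs⟩ | ⟨hp, hs⟩
        · exact ⟨Or.inl hp, Or.inl hs⟩
        · exact ⟨Or.inr hp, Or.inr hs⟩
      · rcases Int.eq_one_or_neg_one_of_mul_eq_neg_one' hd with ⟨hp, hs⟩ | ⟨hp, hs⟩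
        · exact ⟨Or.inl hp, Or.inr hs⟩
        · exact ⟨Or.inr hp, Or.inl hs⟩
    obtain ⟨hp, hs⟩ := hps
    rcases hp with hp | hp <;> rcases hs with hs | hs <;> rw [hp, hs] at e01 <;> omega
  · have hm' : m' = 0 := by
      rcases e00 with h0 | h0
      · exact h0
      · exact absurd h0 hr
    have hm : m = 0 := by
      rcases e11 with h0 | h0
      · exact absurd h0 hr
      · exact h0
    rw [hm, hm']

/-- **THEOREM 10.3 (d)** «Each conjugacy class of nilpotent `2×2` matrices `≠ 0` has a unique representative
`(0 m; 0 0)` with `m ∈ ℕ`»: every nilpotent `N ∈ M_{2×2}(ℤ)` is `GL₂(ℤ)`-conjugate to `(0 m; 0 0)` for exactly one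
`m ∈ ℕ₀`, and `m ≠ 0` iff `N ≠ 0`. [cite: HertlingLarabi2026b, §10.2 Theorem 10.3 (d), chunk p0034] -/
theorem existsUnique_conj_nilpotent_normalForm {N : Matrix (Fin 2) (Fin 2) ℤ} (hN : IsNilpotent N) :
    ∃! m : ℕ, ∃ P : Matrix (Fin 2) (Fin 2) ℤ, IsUnit P.det ∧ P * N = !![0, (m : ℤ); 0, 0] * P := by
  obtain ⟨m, hconj⟩ := exists_conj_nilpotent_normalForm hN
  refine ⟨m, hconj, fun m' hconj' => ?_⟩
  obtain ⟨P, hP, h⟩ := conj_trans (conj_symm hconj') hconj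
  exact nilpotent_normalForm_unique hP h

/-- The representative `(0 m; 0 0)` of a nilpotent `N` is `≠ 0` (i.e. `m ∈ ℕ = {1, 2, …}` as in HL) iff `N ≠ 0`.
[cite: HertlingLarabi2026b, §10.2 Theorem 10.3 (d), chunk p0034] -/
theorem conj_nilpotent_normalForm_ne_zero_iff {N : Matrix (Fin 2) (Fin 2) ℤ} {m : ℕ}
    (h : ∃ P : Matrix (Fin 2) (Fin 2) ℤ, IsUnit P.det ∧ P * N = !![0, (m : ℤ); 0, 0] * P) :
    m ≠ 0 ↔ N ≠ 0 := by
  obtain ⟨P, hP, hPN⟩ := h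
  rw [not_iff_not]
  constructor
  · intro hm
    rw [hm] at hPN
    have h0 : (!![0, ((0 : ℕ) : ℤ); 0, 0] : Matrix (Fin 2) (Fin 2) ℤ) = 0 := by
      ext i j; fin_cases i <;> fin_cases j <;> rfl
    rw [h0, Matrix.zero_mul] at hPN
    have h1 : P⁻¹ * (P * N) = 0 := by rw [hPN, Matrix.mul_zero]
    rwa [← Matrix.mul_assoc, Matrix.nonsing_inv_mul P hP, Matrix.one_mul] at h1
  · intro hN
    rw [hN, Matrix.mul_zero] at hPN
    have e01 := congr_fun (congr_fun hPN 0) 1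
    have e00 := congr_fun (congr_fun hPN 0) 0
    simp [Matrix.mul_apply, Fin.sum_univ_two] at e00 e01
    -- `e00 : m = 0 ∨ P 1 0 = 0`, `e01 : m = 0 ∨ P 1 1 = 0`
    by_contra hm
    have hr : P 1 0 = 0 := e00.resolve_left (by exact_mod_cast hm)
    have hs : P 1 1 = 0 := e01.resolve_left (by exact_mod_cast hm)
    have hd := Int.isUnit_iff.1 hP
    rw [Matrix.det_fin_two, hr, hs, mul_zero, mul_zero, sub_zero] at hd
    omega

/-- **THEOREM 10.3 (d), counted**: the `GL₂(ℤ)`-conjugacy classes of nilpotent integer `2 × 2` matrices are in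
bijection with `ℕ₀` (`[N] ↦ m`, the zero class `↦ 0`); in particular there are infinitely many (HL26b Rem. 6.3
(iv)–(v) for `f = t²`). [cite: HertlingLarabi2026b, §10.2 Theorem 10.3 (d), chunk p0034] -/
theorem exists_bijective_quot_conj_nilpotent :
    ∃ F : (Quot fun N N' : {N : Matrix (Fin 2) (Fin 2) ℤ // IsNilpotent N} =>
      ∃ P : Matrix (Fin 2) (Fin 2) ℤ, IsUnit P.det ∧ P * N.1 = N'.1 * P) → ℕ,
      Function.Bijective F ∧ ∀ m : ℕ, ∀ h, F (Quot.mk _ ⟨!![0, (m : ℤ); 0, 0], h⟩) = m := by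
  set S := {N : Matrix (Fin 2) (Fin 2) ℤ // IsNilpotent N}
  set r : S → S → Prop := fun N N' => ∃ P : Matrix (Fin 2) (Fin 2) ℤ, IsUnit P.det ∧ P * N.1 = N'.1 * P
    with hr_def
  have hr : Equivalence r := equivalence_conj _
  have hnil : ∀ m : ℕ, IsNilpotent (!![0, (m : ℤ); 0, 0] : Matrix (Fin 2) (Fin 2) ℤ) := fun m => by
    rw [isNilpotent_iff_trace_eq_zero_and_det_eq_zero, Matrix.trace_fin_two_of, Matrix.det_fin_two_of]
    constructor <;> ring
  set Nm : ℕ → S := fun m => ⟨!![0, (m : ℤ); 0, 0], hnil m⟩ with hNm_def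
  have hex : ∀ N : S, ∃ m : ℕ, r N (Nm m) := fun N => exists_conj_nilpotent_normalForm N.2
  choose f hf using hex
  have hU : ∀ m m' : ℕ, r (Nm m) (Nm m') → m = m' := by
    rintro m m' ⟨P, hP, h⟩
    exact nilpotent_normalForm_unique hP h
  have hwd : ∀ N N' : S, r N N' → f N = f N' := fun N N' h =>
    hU _ _ (hr.trans (hr.trans (hr.symm (hf N)) h) (hf N'))
  have hval : ∀ m : ℕ, ∀ h, Quot.lift f hwd (Quot.mk _ ⟨!![0, (m : ℤ); 0, 0], h⟩) = m := fun m h =>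
    hU _ _ (hr.trans (hr.symm (hf ⟨_, h⟩)) (hr.refl _))
  refine ⟨Quot.lift f hwd, ⟨?_, fun m => ⟨Quot.mk r (Nm m), hval m (hnil m)⟩⟩, hval⟩
  rintro ⟨N⟩ ⟨N'⟩ h
  change f N = f N' at h
  exact Quot.sound (hr.trans (hf N) (h ▸ hr.symm (hf N')))

/-! ## §5 The order of the class: `ℚ[B] ∩ M_{2×2}(ℤ) = ℤ·1 + ℤ·(1/g)B`, `g = gcd(λ, μ)` -/

/-- The rational matrix of the normal form. [folklore] -/
private theorem map_normalForm (t μ : ℤ) :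
    (!![t, μ; 0, 0] : Matrix (Fin 2) (Fin 2) ℤ).map (Int.castRingHom ℚ) = !![(t : ℚ), (μ : ℚ); 0, 0] := by
  ext i j
  fin_cases i <;> fin_cases j <;> simp

/-- `x·1 + y·(t μ; 0 0) = (x + yt, yμ; 0, x)`. [folklore] -/
private theorem smul_one_add_smul_normalForm (t μ : ℤ) (x y : ℚ) :
    x • (1 : Matrix (Fin 2) (Fin 2) ℚ) + y • !![(t : ℚ), (μ : ℚ); 0, 0] = !![x + y * t, y * μ; 0, x] := by
  ext i j
  fin_cases i <;> fin_cases j <;> simp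

/-- **The order of the class of `(λ μ; 0 0)`, matrix form** (HL26b Thm. 9.4: «This matrix comes from an `ε`-class
of full lattices with order with `ℤ`-basis `e(α 1; 0 1)` where `α = λ/(λ, μ)`»; Thm. 10.3 (d): «It comes from the
`ε`-class of full lattices which contains the order `ℤ·1_A + ℤ·(1/m)a`»): for `(λ, μ) ≠ (0, 0)` and rational `x, y`,
**`x·1 + y·(λ μ; 0 0)` is an integer matrix iff `x ∈ ℤ` and `y·gcd(λ, μ) ∈ ℤ`**, i.e.
`ℚ[B] ∩ M_{2×2}(ℤ) = ℤ·1 ⊕ ℤ·B/gcd(λ, μ)` — the order `ℤ[t̄/g] ≅ ℤ[t]/(t(t − α))`, `α = λ/g`, which under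
`A = ℚ[t]/(t(t − λ)) ≅ ℚe₁ ⊕ ℚe₂` (`t̄ ↦ λe₁`) is `ℤ·αe₁ + ℤ·(e₁ + e₂) = e(α 1; 0 1)·ℤ²`.
[cite: HertlingLarabi2026b, §9.2 Theorem 9.4 (chunk p0029) and §10.2 Theorem 10.3 (d) (chunk p0034)] -/
theorem exists_int_eq_smul_one_add_smul_iff {t μ : ℤ} (h : t ≠ 0 ∨ μ ≠ 0) (x y : ℚ) :
    (∃ C : Matrix (Fin 2) (Fin 2) ℤ, C.map (Int.castRingHom ℚ) =
        x • (1 : Matrix (Fin 2) (Fin 2) ℚ) + y • (!![t, μ; 0, 0] : Matrix (Fin 2) (Fin 2) ℤ).map (Int.castRingHom ℚ)) ↔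
      (∃ a : ℤ, (a : ℚ) = x) ∧ ∃ b : ℤ, (b : ℚ) = y * (Int.gcd t μ : ℤ) := by
  rw [map_normalForm, smul_one_add_smul_normalForm]
  set g : ℤ := ((Int.gcd t μ : ℕ) : ℤ) with hg_def
  have hbez : (g : ℚ) = t * Int.gcdA t μ + μ * Int.gcdB t μ := by
    rw [hg_def]; exact_mod_cast Int.gcd_eq_gcd_ab t μ
  constructor
  · rintro ⟨C, hC⟩
    have e00 := congr_fun (congr_fun hC 0) 0
    have e01 := congr_fun (congr_fun hC 0) 1
    have e11 := congr_fun (congr_fun hC 1) 1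
    simp at e00 e01 e11
    -- `e00 : ↑(C 0 0) = x + y * t`, `e01 : ↑(C 0 1) = y * μ`, `e11 : ↑(C 1 1) = x`
    refine ⟨⟨C 1 1, e11⟩, (C 0 0 - C 1 1) * Int.gcdA t μ + C 0 1 * Int.gcdB t μ, ?_⟩
    push_cast
    rw [e00, e01, e11, hbez]
    ring
  · rintro ⟨⟨a, ha⟩, ⟨b, hb⟩⟩
    have hg0 : g ≠ 0 := by
      rw [hg_def, Nat.cast_ne_zero, Ne, Int.gcd_eq_zero_iff, not_and_or]
      exact h
    obtain ⟨t₁, ht₁⟩ := Int.gcd_dvd_left t μ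
    obtain ⟨μ₁, hμ₁⟩ := Int.gcd_dvd_right t μ
    have ht₁' : (t : ℚ) = g * t₁ := by rw [hg_def]; exact_mod_cast ht₁
    have hμ₁' : (μ : ℚ) = g * μ₁ := by rw [hg_def]; exact_mod_cast hμ₁
    have e1 : (b : ℚ) * t₁ = y * t := by rw [hb, ht₁']; ring
    have e2 : (b : ℚ) * μ₁ = y * μ := by rw [hb, hμ₁']; ring
    refine ⟨!![a + b * t₁, b * μ₁; 0, a], ?_⟩
    ext i j
    fin_cases i <;> fin_cases j <;> simp [e1, e2, ha]

/-- `f = t(t − λ)` is monic of degree `2`. [folklore] -/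
private theorem monic_X_mul_X_sub_C (t : ℚ) :
    (X * (X - C t) : ℚ[X]).Monic ∧ (X * (X - C t) : ℚ[X]).natDegree = 2 := by
  refine ⟨monic_X.mul (monic_X_sub_C t), ?_⟩
  rw [monic_X.natDegree_mul (monic_X_sub_C t), natDegree_X, natDegree_X_sub_C]

/-- `B² = λB` for the normal form, so `f(B) = 0`. [folklore] -/
private theorem aeval_normalForm_eq_zero (t μ : ℤ) :
    aeval (!![(t : ℚ), (μ : ℚ); 0, 0] : Matrix (Fin 2) (Fin 2) ℚ) (X * (X - C (t : ℚ))) = 0 := by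
  have hBB : (!![(t : ℚ), (μ : ℚ); 0, 0] : Matrix (Fin 2) (Fin 2) ℚ) * !![(t : ℚ), (μ : ℚ); 0, 0] =
      (t : ℚ) • !![(t : ℚ), (μ : ℚ); 0, 0] := by
    ext i j
    fin_cases i <;> fin_cases j <;> simp [Matrix.mul_apply, Fin.sum_univ_two]
  rw [map_mul, map_sub, aeval_X, aeval_C, Algebra.algebraMap_eq_smul_one, Matrix.mul_sub, mul_smul_comm,
    Matrix.mul_one, hBB, sub_self]

/-- **The order of the class of `(λ μ; 0 0)` in the tree's Latimer–MacDuffee vocabulary**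
(`LatimerMacDuffeeOrderStrata`: «the order of `[B]_ℤ` is `Λ`» is `∀ p, p(t̄) ∈ Λ ↔ p(B) ∈ M_{2×2}(ℤ)`): for
`f = t(t − λ)`, `A_f = ℚ[t]/(f)`, `g = gcd(λ, μ) ≠ 0`, **`p(t̄) ∈ ℤ·1 + ℤ·(t̄/g) ⟺ p((λ μ; 0 0)) ∈ M_{2×2}(ℤ)`** —
HL26b Thm. 9.4 «order with `ℤ`-basis `e(α 1; 0 1)`, `α = λ/(λ,μ)`» (`t̄ ↦ λe₁` maps `t̄/g ↦ αe₁`) and Thm. 10.3 (d)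
«the order `ℤ·1_A + ℤ·(1/m)a`» (`λ = 0`, `g = m`).
[cite: HertlingLarabi2026b, §9.2 Theorem 9.4 (chunk p0029), §10.2 Theorem 10.3 (d) (chunk p0034), §6 Rem. 6.3 (v)
(chunk p0013)] -/
theorem mk_mem_span_iff {t μ : ℤ} (h : t ≠ 0 ∨ μ ≠ 0) (p : ℚ[X]) :
    AdjoinRoot.mk (X * (X - C (t : ℚ))) p ∈
        Submodule.span ℤ ({1, ((Int.gcd t μ : ℤ) : ℚ)⁻¹ • AdjoinRoot.root (X * (X - C (t : ℚ)))} :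
          Set (AdjoinRoot (X * (X - C (t : ℚ))))) ↔
      ∃ C : Matrix (Fin 2) (Fin 2) ℤ, C.map (Int.castRingHom ℚ) =
        aeval ((!![t, μ; 0, 0] : Matrix (Fin 2) (Fin 2) ℤ).map (Int.castRingHom ℚ)) p := by
  obtain ⟨hf, hnat⟩ := monic_X_mul_X_sub_C (t : ℚ)
  set f : ℚ[X] := X * (X - C (t : ℚ)) with hf_def
  set g : ℤ := ((Int.gcd t μ : ℕ) : ℤ) with hg_def
  have hg0 : g ≠ 0 := by
    rw [hg_def, Nat.cast_ne_zero, Ne, Int.gcd_eq_zero_iff, not_and_or]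
    exact h
  have hgq : (g : ℚ) ≠ 0 := by exact_mod_cast hg0
  set B : Matrix (Fin 2) (Fin 2) ℚ := (!![t, μ; 0, 0] : Matrix (Fin 2) (Fin 2) ℤ).map (Int.castRingHom ℚ)
    with hB_def
  have hB : B = !![(t : ℚ), (μ : ℚ); 0, 0] := map_normalForm t μ
  have hroot : aeval B f = 0 := by rw [hB]; exact aeval_normalForm_eq_zero t μ
  -- every `x·1 + y·t̄` and `x·1 + y·B` with the integrality criterion of the previous theorem
  have key : ∀ x y : ℚ, (x • (1 : AdjoinRoot f) + y • AdjoinRoot.root f ∈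
      Submodule.span ℤ ({1, (g : ℚ)⁻¹ • AdjoinRoot.root f} : Set (AdjoinRoot f))) ↔
        ∃ C : Matrix (Fin 2) (Fin 2) ℤ, C.map (Int.castRingHom ℚ) = x • (1 : Matrix (Fin 2) (Fin 2) ℚ) + y • B := by
    intro x y
    rw [hB_def, exists_int_eq_smul_one_add_smul_iff h x y, Submodule.mem_span_pair]
    constructor
    · rintro ⟨a, b, hab⟩
      -- compare coefficients: `(b/g − y)·t̄ + (a − x)·1 = 0` in `A_f`, so `f ∣ C(b/g − y)·X + C(a − x)`, which is `0`
      have hab' : (a : ℚ) • (1 : AdjoinRoot f) + ((b : ℚ) * (g : ℚ)⁻¹) • AdjoinRoot.root f =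
          x • 1 + y • AdjoinRoot.root f := by
        rw [← hab, ← Int.cast_smul_eq_zsmul ℚ a, ← Int.cast_smul_eq_zsmul ℚ b, smul_smul]
      have hmk : AdjoinRoot.mk f (C ((b : ℚ) * (g : ℚ)⁻¹ - y) * X + C ((a : ℚ) - x)) = 0 := by
        rw [map_add, map_mul, AdjoinRoot.mk_C, AdjoinRoot.mk_C, AdjoinRoot.mk_X, ← AdjoinRoot.algebraMap_eq,
          ← Algebra.smul_def, Algebra.algebraMap_eq_smul_one, sub_smul, sub_smul]
        calc ((b : ℚ) * (g : ℚ)⁻¹) • AdjoinRoot.root f - y • AdjoinRoot.root f + ((a : ℚ) • 1 - x • 1)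
            = ((a : ℚ) • (1 : AdjoinRoot f) + ((b : ℚ) * (g : ℚ)⁻¹) • AdjoinRoot.root f) -
                (x • 1 + y • AdjoinRoot.root f) := by abel
          _ = 0 := sub_eq_zero.2 hab'
      have h0 : C ((b : ℚ) * (g : ℚ)⁻¹ - y) * X + C ((a : ℚ) - x) = 0 :=
        eq_zero_of_dvd_of_natDegree_lt (AdjoinRoot.mk_eq_zero.1 hmk)
          (by rw [hnat]; exact lt_of_le_of_lt natDegree_linear_le one_lt_two)
      have h1 := congr_arg (fun P : ℚ[X] => P.coeff 1) h0
      have h0' := congr_arg (fun P : ℚ[X] => P.coeff 0) h0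
      simp only [coeff_add, coeff_C_mul_X, coeff_C, coeff_zero] at h1 h0'
      norm_num at h1 h0'
      -- `h1 : ↑b * (↑g)⁻¹ - y = 0`, `h0' : ↑a - x = 0`
      refine ⟨⟨a, by linarith⟩, b, ?_⟩
      rw [show y = (b : ℚ) * (g : ℚ)⁻¹ by linarith, inv_mul_cancel_right₀ hgq]
    · rintro ⟨⟨a, ha⟩, ⟨b, hb⟩⟩
      refine ⟨a, b, ?_⟩
      rw [← Int.cast_smul_eq_zsmul ℚ a, ← Int.cast_smul_eq_zsmul ℚ b, smul_smul, ha, hb,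
        mul_inv_cancel_right₀ hgq]
  -- reduce `p` modulo `f` to `x + y t`
  set q := p %ₘ f with hq_def
  have hf1 : f ≠ 1 := by
    intro h1
    rw [h1, natDegree_one] at hnat
    norm_num at hnat
  have hqdeg : q.natDegree ≤ 1 := by
    have := natDegree_modByMonic_lt p hf hf1
    rw [hnat, ← hq_def] at this
    omega
  have hq : q = C (q.coeff 1) * X + C (q.coeff 0) := eq_X_add_C_of_natDegree_le_one hqdeg
  have hmk : AdjoinRoot.mk f p = (q.coeff 0) • (1 : AdjoinRoot f) + (q.coeff 1) • AdjoinRoot.root f := by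
    have hpq : AdjoinRoot.mk f p = AdjoinRoot.mk f q := by
      rw [AdjoinRoot.mk_eq_mk]
      exact ⟨p /ₘ f, by linear_combination (-1 : ℚ[X]) * modByMonic_add_div p f⟩
    rw [hpq]
    conv_lhs => rw [hq]
    rw [map_add, map_mul, AdjoinRoot.mk_C, AdjoinRoot.mk_C, AdjoinRoot.mk_X,
      ← AdjoinRoot.algebraMap_eq, ← Algebra.smul_def, Algebra.algebraMap_eq_smul_one, add_comm]
  have haev : aeval B p = (q.coeff 0) • (1 : Matrix (Fin 2) (Fin 2) ℚ) + (q.coeff 1) • B := by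
    rw [← aeval_modByMonic_eq_self_of_root (p := p) hroot, ← hq_def]
    conv_lhs => rw [hq]
    rw [map_add, map_mul, aeval_C, aeval_C, aeval_X, Algebra.algebraMap_eq_smul_one,
      Algebra.algebraMap_eq_smul_one, smul_one_mul, add_comm]
  rw [hmk, haev]
  exact key _ _

/-- The normal form `(λ μ; 0 0) ≠ 0` is regular with `p_B = t(t − λ)` (it is the rank-one matrix `e₁·(λ, μ)`, tree
`RankOneMinpoly.minpoly_vecMulVec`), so `[B]_ℤ ∈ S_{1,f}`, `f = t(t − λ)` (HL26b Thm. 6.2/6.3 for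
`A_f = ℚ[t]/(t(t − λ))`: `≅ ℚe₁ ⊕ ℚe₂` if `λ ≠ 0` (§9.2), `= ℚ[a]/(a²)` if `λ = 0` (§10.2)).
[cite: HertlingLarabi2026b, §9.2 Example 9.3 (chunk p0028), §10.2 Theorem 10.3 (d) (chunk p0034)] -/
theorem minpoly_map_normalForm {t μ : ℤ} (h : t ≠ 0 ∨ μ ≠ 0) :
    minpoly ℚ ((!![t, μ; 0, 0] : Matrix (Fin 2) (Fin 2) ℤ).map (Int.castRingHom ℚ)) = X * (X - C (t : ℚ)) := by
  rw [map_normalForm]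
  have hv : (!![(t : ℚ), (μ : ℚ); 0, 0] : Matrix (Fin 2) (Fin 2) ℚ) = vecMulVec ![1, 0] ![(t : ℚ), (μ : ℚ)] := by
    ext i j
    fin_cases i <;> fin_cases j <;> simp [vecMulVec_apply]
  have hx : (![1, 0] : Fin 2 → ℚ) ≠ 0 := fun h0 => by simpa using congr_fun h0 0
  have hw : (![(t : ℚ), (μ : ℚ)] : Fin 2 → ℚ) ≠ 0 := by
    intro h0
    have h1 := congr_fun h0 0
    have h2 := congr_fun h0 1
    simp only [Matrix.cons_val_zero, Matrix.cons_val_one, Pi.zero_apply, Int.cast_eq_zero] at h1 h2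
    rcases h with h | h
    · exact h h1
    · exact h h2
  rw [hv, RankOneMinpoly.minpoly_vecMulVec hx hw]
  simp [dotProduct, Fin.sum_univ_two]

/-- **THEOREM 9.4 / 10.3 (d), the order clause, in the vocabulary of `LatimerMacDuffeeOrderStrata`**: the order
of the conjugacy class of `(λ μ; 0 0)` (the unique `Λ` with `p(t̄) ∈ Λ ⟺ p(B) ∈ M_{2×2}(ℤ)`, `order_unique`) is
`ℤ·1 + ℤ·t̄/gcd(λ, μ) ⊂ A_f`, `f = t(t − λ)` — «order with `ℤ`-basis `e(α 1; 0 1)` where `α = λ/(λ,μ)`»,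
resp. «the order `ℤ·1_A + ℤ·(1/m)a`». [cite: HertlingLarabi2026b, §9.2 Theorem 9.4 (chunk p0029), §10.2
Theorem 10.3 (d) (chunk p0034)] -/
theorem order_eq_span_of_normalForm {t μ : ℤ} (h : t ≠ 0 ∨ μ ≠ 0)
    {Λ : Submodule ℤ (AdjoinRoot (X * (X - C (t : ℚ))))}
    (hΛ : ∀ p : ℚ[X], AdjoinRoot.mk (X * (X - C (t : ℚ))) p ∈ Λ ↔
      ∃ C : Matrix (Fin 2) (Fin 2) ℤ, C.map (Int.castRingHom ℚ) =
        aeval ((!![t, μ; 0, 0] : Matrix (Fin 2) (Fin 2) ℤ).map (Int.castRingHom ℚ)) p) :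
    Λ = Submodule.span ℤ ({1, ((Int.gcd t μ : ℤ) : ℚ)⁻¹ • AdjoinRoot.root (X * (X - C (t : ℚ)))} :
      Set (AdjoinRoot (X * (X - C (t : ℚ))))) :=
  order_unique hΛ (mk_mem_span_iff h)

/-- **THEOREM 9.4 / 10.3 (d) with THEOREM 6.2: «this matrix comes from an `ε`-class of full lattices with order …»**
— `(λ μ; 0 0)`, `(λ, μ) ≠ (0, 0)`, is represented (`t̄𝔅 = 𝔅·B`) by a `ℤ`-basis `𝔅` of a full `t̄`-stable lattice
`L ⊂ A_f = ℚ[t]/(t(t − λ))` whose order `𝒪(L) = L : L` is `ℤ·1 + ℤ·t̄/gcd(λ, μ)` (tree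
`LatimerMacDuffeeOrderStrata.exists_order_of_minpoly_eq` + `order_eq_span_of_normalForm`).
[cite: HertlingLarabi2026b, §9.2 Theorem 9.4 (chunk p0029), §10.2 Theorem 10.3 (d) (chunk p0034), §6 Theorem 6.2
(chunk p0012)] -/
theorem exists_lattice_of_normalForm {t μ : ℤ} (h : t ≠ 0 ∨ μ ≠ 0) :
    ∃ L : Submodule ℤ (AdjoinRoot (X * (X - C (t : ℚ)))),
      IsFullLattice (AdjoinRoot (X * (X - C (t : ℚ)))) L ∧
      (∀ x ∈ L, AdjoinRoot.root (X * (X - C (t : ℚ))) * x ∈ L) ∧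
      L / L = Submodule.span ℤ ({1, ((Int.gcd t μ : ℤ) : ℚ)⁻¹ • AdjoinRoot.root (X * (X - C (t : ℚ)))} :
        Set (AdjoinRoot (X * (X - C (t : ℚ))))) ∧
      ∃ b : Module.Basis (Fin 2) ℚ (AdjoinRoot (X * (X - C (t : ℚ)))), Submodule.span ℤ (Set.range b) = L ∧
        ∀ j, AdjoinRoot.root (X * (X - C (t : ℚ))) * b j =
          ∑ i, (((!![t, μ; 0, 0] : Matrix (Fin 2) (Fin 2) ℤ) i j : ℤ) : ℚ) • b i := by
  obtain ⟨hf, hnat⟩ := monic_X_mul_X_sub_C (t : ℚ)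
  obtain ⟨Λ, hΛ, -, -, -, -, L, hL, hLroot, hLΛ, b, hb, hbB⟩ :=
    exists_order_of_minpoly_eq hf hnat (minpoly_map_normalForm h)
  exact ⟨L, hL, hLroot, by rw [hLΛ, order_eq_span_of_normalForm h hΛ], b, hb, hbB⟩

end Literature.LinearAlgebra.Matrix.GL2ZSingularNormalForm
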